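import Summits.CriticalPhenomena.PercolationContinuityZ3.Theorems.PercNearOneGluingNoHeavyLowerTailIncStarIrreducibleTwo
import Summits.CriticalPhenomena.PercolationContinuityZ3.Theorems.PercNearOneGluingNoHeavyLowerTailFrontierIncRowsLeFive
import HarnessLib

/-!
# The increasing star reduces to irreducible marked graphs with 2-connected environment, at least two cycles and at least six vertices
# (computational companion)

Support file for the Sahi programme (`--supports stmt-CriticalPhenomena-4575`, prover prim-sahi-p2 gen 23).  COMPUTATIONAL: it combines the
kernel reduction theorem `IncStarIrreducible.incStar_of_irreducible₂` (standard axioms; gens 8–12, 21 and THEOREM G of gens 22/23) with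
prim-bnk-1's five-vertex theorem `FrontierIncRows.incStar_le_five`, which rests on `native_decide` comb certificates — so the theorem below
inherits those `native_decide` axioms and is to be cited as CERTIFIED, never as kernel.  No definitions, no named facts, no sorries.  Memo
`…/prim-sahi-p2/PROOF-E3.md` §33.

* `incStar_of_irreducible₂_six`: if the increasing star `0 ≤ E₃({s↔a},{s↔b},{s↔c})` holds for every IRREDUCIBLE marked weighted graph on
  `Fin n` with `6 ≤ n` whose environment `G − s` is 2-connected with cyclomatic number `≥ 2` and at which E-MIN fails along every fractional
  environment pair (clauses as in `…IncStarIrreducibleTwo`), then it holds on every finite weighted graph.  (The exact K₇ / M₈ fibre certificates of the programme would raise `6` to `8` / `9`; they are not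
  Lean theorems.)
-/

noncomputable section

namespace Summit.CriticalPhenomena.PercolationContinuityZ3.Theorems

namespace IncStarIrreducible

open Finset MeasureTheory Literature.Combinatorics.Sahi2008 Literature.Probability.Percolation
  Literature.Probability.LatticeModels
open scoped Classical

/-- **Reduction to irreducible marked graphs with 2-connected environment, at least two cycles and at least six vertices** (certified:
inherits the `native_decide` axioms of `FrontierIncRows.incStar_le_five` for the graphs on at most five vertices). [this work] -/
theorem incStar_of_irreducible₂_six
    (H : ∀ (n : ℕ) (w : Sym2 (Fin n) → unitInterval) (s a b c : Fin n), 6 ≤ n →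
      s ≠ a → s ≠ b → s ≠ c → a ≠ b → a ≠ c → b ≠ c →
      (∀ x : Fin n, w s(x, x) = 0) →
      (∀ (V₁ V₂ : Finset (Fin n)) (x : Fin n), (∀ y, y ∈ V₁ → y ∈ V₂ → y = x) → x ∈ V₁ → x ∈ V₂ → s ∈ V₁ →
          (∀ y, y ∈ V₁ ∨ y ∈ V₂) → (∀ y z, y ∈ V₁ → z ∈ V₂ → y ≠ x → z ≠ x → w s(y, z) = 0) →
          (∀ y ∈ V₁, y = x) ∨ (∀ z ∈ V₂, z = x)) →
      (∀ x y y' : Fin n, x ≠ s → x ≠ a → x ≠ b → x ≠ c → x ≠ y → x ≠ y' → y ≠ y' →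
          ∃ z, z ≠ y ∧ z ≠ y' ∧ w s(x, z) ≠ 0) →
      (∀ (B : Finset (Fin n)) (u v : Fin n), B.Nonempty → u ∉ B → v ∉ B → u ≠ v → s ∉ B → a ∉ B → b ∉ B → c ∉ B →
          ∃ x ∈ B, ∃ z, z ∉ B ∧ z ≠ u ∧ z ≠ v ∧ w s(x, z) ≠ 0) →
      (∀ (R : Finset (Fin n)) (h u v : Fin n), s ∈ R → h ∈ R → h ≠ s → u ∉ R → v ∉ R → u ≠ v → a ∉ R → b ∉ R →
          c ∉ R → ∃ x ∈ R, ∃ z, z ∉ R ∧ z ≠ u ∧ z ≠ v ∧ w s(x, z) ≠ 0) →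
      (∀ (L : Finset (Fin n)) (x : Fin n), x ≠ s → s ∉ L → x ∉ L → L.Nonempty → (∃ y, y ∉ L ∧ y ≠ s ∧ y ≠ x) →
          ∃ y ∈ L, ∃ z, z ∉ L ∧ z ≠ s ∧ z ≠ x ∧ w s(y, z) ≠ 0) →
      (∀ z₀ : Sym2 (Fin n),
          ¬ ((SimpleGraph.fromEdgeSet {z : Sym2 (Fin n) | s ∉ z ∧ w z ≠ 0}).deleteEdges {z₀}).IsAcyclic) →
      (∃ e : Sym2 (Fin n), s ∉ e ∧ ¬ e.IsDiag ∧ e ∈ EdgeInduction.fracEdges w) →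
      (∀ e : Sym2 (Fin n), s ∉ e → ¬ e.IsDiag → e ∈ EdgeInduction.fracEdges w →
          sahiE3 (prodBernoulli w) (openConn s a) (openConn s b) (openConn s c)
              < sahiE3 (prodBernoulli (Function.update w e 0)) (openConn s a) (openConn s b) (openConn s c) ∧
            sahiE3 (prodBernoulli w) (openConn s a) (openConn s b) (openConn s c)
              < sahiE3 (prodBernoulli (Function.update w e 1)) (openConn s a) (openConn s b) (openConn s c)) →
      0 ≤ sahiE3 (prodBernoulli w) (openConn s a) (openConn s b) (openConn s c))
    {V : Type*} [Fintype V] (w : Sym2 V → unitInterval) (s a b c : V) :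
    0 ≤ sahiE3 (prodBernoulli w) (openConn s a) (openConn s b) (openConn s c) := by
  refine incStar_of_irreducible₂ (fun n w s a b c hsa hsb hsc hab hac hbc h0 h1 h2 h3 h4 h5 h6 h7 h8 => ?_) w s a b c
  rcases Nat.lt_or_ge n 6 with hn | hn
  · exact FrontierIncRows.incStar_le_five (by omega) w s a b c hsa hsb hsc hab hac hbc
  · exact H n w s a b c hn hsa hsb hsc hab hac hbc h0 h1 h2 h3 h4 h5 h6 h7 h8

end IncStarIrreducible

end Summit.CriticalPhenomena.PercolationContinuityZ3.Theorems
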